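import Summits.Ventures.HSemireg.WedgeHankelRecurrenceGaussChebyshevMarkovBound
import Literature.Algebra.Polynomial.ChebyshevExplicitForms
import Literature.Algebra.Polynomial.ChebyshevCoefficientFormulas

/-!
# Venture HSemireg — **CASSINI IDENTITIES FOR MATHLIB'S CHEBYSHEV POLYNOMIALS, ALL INTEGER INDICES, ANY COMMUTATIVE RING**: `U_n² + U_{n+1}² − 2X U_n U_{n+1} = 1` (Mathlib's `S`-identity
# composed with `2X`), **`U_n² − U_{n+1} U_{n−1} = 1`**, hence **`U_{n+1}`, `U_n` coprime** and `U_{n+1}(x) U_{n−1}(x) = −1` at every zero of `U_n`; **`T_n² − T_{n+1} T_{n−1} = 1 − X²`**, hence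
# `T_{n+2}(x) T_n(x) = x² − 1 < 0` at every zero `x ∈ (−1,1)` of `T_{n+1}` (sign alternation behind the interlacing of consecutive Gauss–Chebyshev node sets)

HONEST FRAMING. Part of the Lean index of the computation cell `pub-hsemireg` (seat p10 gen 47, Sunday typer «UNIFORM-IN-n»).  Polynomial algebra only; no variety, no cohomology theory, no
sheaf, no Ext group and no semiregularity map is constructed here; nothing here says that HC / HC_CM / HC_AV holds; no Literature fact (unproved `Prop`) is declared or used.  Custodian versions as
in `WedgeHankelSiegelIdeal` (1/3).
SOURCES (cited).  T. J. Rivlin, *Chebyshev Polynomials* (1990), §1.2, Ex. 1.2.x (Cassini ∕ Turán-type identities); P. Turán, Časopis Pěst. Mat. Fys. 75 (1950) 113–122; G. Szegő, *On an inequality of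
P. Turán concerning Legendre polynomials*, Bull. AMS 54 (1948) 401–405; Mathlib `Polynomial.Chebyshev.S_sq_add_S_sq`.  The `U`-identity for `n ∈ ℕ` over `ℝ` is §1136 `chebyshevU_turan`; here all
`n ∈ ℤ` and any commutative ring; the `T`-identity is the landed `Literature…ChebyshevExplicitForms.T_sq_sub_T_mul_T` (re-indexed, imported).
PROOF TYPED HERE.  Mathlib `S_sq_add_S_sq`, `S_comp_two_mul_X` (composition with `2X`), `U_sub_one`; `Literature…T_sq_sub_T_mul_T` at `n − 1` for `T`.
DEDUP DISCLOSURE (`rg -n -i 'cassini|turan|T_sq_sub|isCoprime_chebyshev' Summits Literature`, 2026-09-04): §1136 `chebyshevU_turan` (`ℝ`, `n ∈ ℕ`); `Literature…ChebyshevExplicitForms.T_sq_sub_T_mul_T`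
(the `T`-Cassini identity, imported — not re-proved) and `T_eval_sq_sub_T_eval_mul_T_eval`; `Literature…ChebyshevCoefficientFormulas.isCoprime_chebyshevU_succ_nat` (`ℕ`-indexed consecutive-`U`
coprimality; the `ℤ`-indexed form below is new); N82x `HankelCassini`; 0 hits for the 7 names below.

WHAT IS IN THE TREE.  §1136 `chebyshevU_turan`; `Literature…T_sq_sub_T_mul_T`, `isCoprime_chebyshevU_succ_nat`; N443 `chebyshev_pell`, `chebyshev_isCoprime_T_U`; Mathlib as listed.
THIS FILE (namespace `Summit.Ventures.HSemireg.Wedge.HankelOuter` continued; CHAINED on N444; 0 definitions):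
* §1210 `chebyshevU_sq_add_sq`, **`chebyshevU_cassini`**, **`chebyshev_isCoprime_U_succ`**, `chebyshevU_mul_eval_at_zero`, **`chebyshevT_cassini`**, `chebyshevT_mul_eval_at_zero`,
  `chebyshevT_mul_eval_at_zero_neg`.
CAVEATS.  Nothing Ext-side.  New names only.
-/

open Module Polynomial
open scoped Matrix Polynomial

namespace Summit.Ventures.HSemireg.Wedge.HankelOuter

/-! ## §1210. Cassini identities -/

/-- `U_n² + U_{n+1}² − 2X U_n U_{n+1} = 1` (Mathlib's `S`-identity at `2X`). [Mathlib `S_sq_add_S_sq`; Rivlin §1.2; this file, §1210] -/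
theorem chebyshevU_sq_add_sq {R : Type*} [CommRing R] (n : ℤ) :
    Polynomial.Chebyshev.U R n ^ 2 + Polynomial.Chebyshev.U R (n + 1) ^ 2 - 2 * Polynomial.X * Polynomial.Chebyshev.U R n * Polynomial.Chebyshev.U R (n + 1) = 1 := by
  have h := congrArg (fun p => p.comp (2 * Polynomial.X)) (Polynomial.Chebyshev.S_sq_add_S_sq R n)
  simp only [sub_comp, add_comp, pow_comp, mul_comp, X_comp, Polynomial.Chebyshev.S_comp_two_mul_X, one_comp] at h
  linear_combination h

/-- **CASSINI FOR `U`: `U_n² − U_{n+1} U_{n−1} = 1`** (all `n ∈ ℤ`, any commutative ring). [Rivlin §1.2; §1136 for `n ∈ ℕ` over `ℝ`; this file, §1210] -/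
theorem chebyshevU_cassini {R : Type*} [CommRing R] (n : ℤ) :
    Polynomial.Chebyshev.U R n ^ 2 - Polynomial.Chebyshev.U R (n + 1) * Polynomial.Chebyshev.U R (n - 1) = 1 := by
  rw [Polynomial.Chebyshev.U_sub_one]
  linear_combination chebyshevU_sq_add_sq (R := R) n

/-- **Consecutive `U_{n+1}`, `U_n` are coprime** for every `n ∈ ℤ` (Bézout: `(−U_{n−1}) U_{n+1} + U_n U_n = 1`; the `ℕ`-indexed, order-swapped statement is the landed
`Literature.Algebra.Polynomial.ChebyshevCoefficientFormulas.isCoprime_chebyshevU_succ_nat`). [corollary; this file, §1210] -/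
theorem chebyshev_isCoprime_U_succ {R : Type*} [CommRing R] (n : ℤ) : IsCoprime (Polynomial.Chebyshev.U R (n + 1)) (Polynomial.Chebyshev.U R n) :=
  ⟨-Polynomial.Chebyshev.U R (n - 1), Polynomial.Chebyshev.U R n, by linear_combination chebyshevU_cassini (R := R) n⟩

/-- At a zero `x` of `U_n`: **`U_{n+1}(x) U_{n−1}(x) = −1`.** [corollary; this file, §1210] -/
theorem chebyshevU_mul_eval_at_zero {R : Type*} [CommRing R] (n : ℤ) {x : R} (hx : (Polynomial.Chebyshev.U R n).eval x = 0) :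
    (Polynomial.Chebyshev.U R (n + 1)).eval x * (Polynomial.Chebyshev.U R (n - 1)).eval x = -1 := by
  have h := congrArg (Polynomial.eval x) (chebyshevU_cassini (R := R) n)
  simp only [eval_sub, eval_pow, eval_mul, eval_one, hx] at h
  linear_combination -h

/-- **CASSINI FOR `T`: `T_n² − T_{n+1} T_{n−1} = 1 − X²`** (all `n ∈ ℤ`, any commutative ring) — the index shift of the LANDED
`Literature.Algebra.Polynomial.ChebyshevExplicitForms.T_sq_sub_T_mul_T` (Rivlin Ex. 1.5.18). [Rivlin §1.5; Turán 1950; this file, §1210] -/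
theorem chebyshevT_cassini {R : Type*} [CommRing R] (n : ℤ) :
    Polynomial.Chebyshev.T R n ^ 2 - Polynomial.Chebyshev.T R (n + 1) * Polynomial.Chebyshev.T R (n - 1) = 1 - Polynomial.X ^ 2 := by
  have h := Literature.Algebra.Polynomial.ChebyshevExplicitForms.T_sq_sub_T_mul_T R (n - 1)
  rw [sub_add_cancel, show n - 1 + 2 = n + 1 by ring] at h
  linear_combination h

/-- At a zero `x` of `T_{n+1}`: **`T_{n+2}(x) T_n(x) = x² − 1`** (any commutative ring). [corollary; this file, §1210] -/
theorem chebyshevT_mul_eval_at_zero {R : Type*} [CommRing R] (n : ℤ) {x : R} (hx : (Polynomial.Chebyshev.T R (n + 1)).eval x = 0) :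
    (Polynomial.Chebyshev.T R (n + 2)).eval x * (Polynomial.Chebyshev.T R n).eval x = x ^ 2 - 1 := by
  have h := congrArg (Polynomial.eval x) (chebyshevT_cassini (R := R) (n + 1))
  rw [show n + 1 + 1 = n + 2 by ring, show n + 1 - 1 = n by ring] at h
  simp only [eval_sub, eval_pow, eval_mul, eval_one, eval_X, hx] at h
  linear_combination -h

/-- At a zero `x ∈ (−1, 1)` of `T_{n+1}`: **`T_{n+2}(x) T_n(x) < 0`** — the neighbours have opposite signs there. [corollary; this file, §1210] -/
theorem chebyshevT_mul_eval_at_zero_neg (n : ℤ) {x : ℝ} (hx1 : |x| < 1) (hx : (Polynomial.Chebyshev.T ℝ (n + 1)).eval x = 0) :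
    (Polynomial.Chebyshev.T ℝ (n + 2)).eval x * (Polynomial.Chebyshev.T ℝ n).eval x < 0 := by
  rw [chebyshevT_mul_eval_at_zero n hx]
  have := abs_lt.1 hx1
  nlinarith

end Summit.Ventures.HSemireg.Wedge.HankelOuter
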